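import Literature.AlgebraicGeometry.Frobenioids.PiMonoprimePerfFactorial
import Literature.AlgebraicGeometry.Frobenioids.Prop53Sub
import Literature.AlgebraicGeometry.Frobenioids.RealificationMapNotInjective
import Literature.AlgebraicGeometry.Frobenioids.RealificationMapInjectiveFiniteSupp
import Literature.AlgebraicGeometry.Frobenioids.PerfectionPrimes
import Mathlib.Data.NNRat.Encodable
import Mathlib.Order.Filter.CountableInter
import Mathlib.Order.Filter.Ultrafilter.Defs
import HarnessLib

/-!
# Frobenioids I, Prop. 5.3 sub-DAG: the slot `RlfMapInjective'` is REFUTABLE from a countably complete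
# free ultrafilter (finding P53-F2 — set-theoretic independence of the disjoint-supports injectivity row)

Mochizuki, *The geometry of Frobenioids I*, Kyushu J. Math. **62** (2008), Def. 2.4 (i) p. 48 (`M^rlf`),
Prop. 5.3 p. 103 l. 12 ("the divisor monoid `Φ^rlf`") [cite: MochizukiFrdI2008, Prop. 5.3 p.103].

The typed slot `FrdI.Prop53Sub.RlfMapInjective'` (`Prop53Sub.lean`; cell sub-DAG W3 row P53/L02a′) asserts, for
ALL perf-factorial `M`, `N` (in a universe `w`) and every characteristically injective `f : M → N` under which
primary elements of distinct primes of `M^pf` have images with pairwise disjoint supports in `N^rlf`, that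
`f^rlf = IsPerfFactorial.Rlf.map` is injective.  `RealificationMapInjectiveFiniteSupp.lean` proves it for
finitely supported `M` (the divisor monoids of the paper).  THIS file proves

  `not_rlfMapInjective'_of_countableInter_ultrafilter :`
  `(∃ (A : Type w) (U : Ultrafilter A), CountableInterFilter ↑U ∧ ∀ a, {a}ᶜ ∈ U) → ¬ RlfMapInjective'`,

i.e. the slot is refutable from the existence of a countably complete non-principal ultrafilter on some type of
the universe (a measurable cardinal) — an object Lean's axioms can neither construct nor exclude; since WITHOUT
such an ultrafilter every monotone additive map out of a full product `∏_A ℝ_{≥0}` is determined prime by prime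
and the slot holds, the slot as typed is independent of the kernel's axioms (finding P53-F2, seat
abc-iut-w4-d084; cell GAP-LEDGER row G-w4d084-1: repaired reading = finite supports).

**The witness.** `M := (A ⊕ A → ℚ_{≥0})` (`WM A`), a FULL product of `ℚ`-monoprime monoids (perf-factorial:
`PiMonoprimePerfFactorial.lean`); `N := M^rlf`; `L` = the `U`-limit of a `ℚ_{≥0}`-valued function (countable
codomain: exactly one fibre lies in `U`), a homomorphism vanishing on functions trivial on a member of `U`;
`f(a) := ι(a) · ι(𝟙₁)^{√2 · L(a|₂)} · ι(𝟙₂)^{L(a|₁)/√2}` (`witnessHom`; `𝟙ⱼ` the indicator of the `j`-th copy of `A`,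
real powers `IsPerfFactorial.Rlf.rpow` of seat abc-iut-L1-d2).  Then: `f` is a homomorphism; it is injective
(project to one coordinate: `a_i + √2 · (rational) = b_i + √2 · (rational)` forces `a_i = b_i` — `√2 ∉ ℚ`), hence
characteristically injective (sharp monoids); a primary element of `M^pf = M` is supported at ONE index, so
its ghost exponents vanish (`U` is free) and `f^pf` maps it to `ι` of itself, a primary element of `N` —
distinct primes go to distinct primes of `N`, whose `ι_N`-images have singleton, hence disjoint, supports; yet
`f^rlf(ι 𝟙₂) = ι_N(ι 𝟙₂ · ι(𝟙₁)^{√2}) = f^rlf(ι(𝟙₁)^{√2})` (`Rlf.map` lies over `f^pf` and EVERY homomorphism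
of realifications commutes with real powers, `RlfHomEquivariant.lean`) while `ι 𝟙₂ ≠ ι(𝟙₁)^{√2}`.
The constructions `WM`, `indicator₁/₂`, `restrict₁/₂`, `ghostExp`, `witnessHom` are witness data for this one
theorem (not notions of the paper).  Seat abc-iut-w4-d084 (cell abc-iut).  Nothing here bears on [IUTchIII]
Cor. 3.12; no position is taken on measurable cardinals either — the theorem is an implication.
-/

noncomputable section

namespace Literature.AlgebraicGeometry.Frobenioids

open Function Literature.AnabelianGeometry.EtaleTheta

universe w

namespace P53F2

/-! ### Ultrafilter limits of functions with countable range -/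

section Ultrafilter

variable {A : Type w} (U : Ultrafilter A) [CountableInterFilter (U : Filter A)]

/-- For a countably complete ultrafilter `U` and a `ℚ_{≥0}`-valued function `g`, some fibre of `g` lies in `U`
(the complements of the countably many fibres cannot all lie in `U`: their intersection is empty). [folklore] -/
private theorem exists_fibre_mem (g : A → Multiplicative ℚ≥0) : ∃ q : Multiplicative ℚ≥0, g ⁻¹' {q} ∈ (U : Filter A) := by
  by_contra h
  haveI : Countable (Multiplicative ℚ≥0) := inferInstanceAs (Countable ℚ≥0)
  have hall : ∀ q : Multiplicative ℚ≥0, (g ⁻¹' {q})ᶜ ∈ (U : Filter A) := fun q =>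
    Ultrafilter.compl_mem_iff_notMem.mpr fun hq => h ⟨q, hq⟩
  have hI : (⋂ q : Multiplicative ℚ≥0, (g ⁻¹' {q})ᶜ) ∈ (U : Filter A) := (countable_iInter_mem).mpr hall
  have hempty : (⋂ q : Multiplicative ℚ≥0, (g ⁻¹' {q})ᶜ) = ∅ := by
    ext a
    simp only [Set.mem_iInter, Set.mem_compl_iff, Set.mem_preimage, Set.mem_singleton_iff,
      Set.mem_empty_iff_false, iff_false, not_forall, not_not]
    exact ⟨g a, rfl⟩
  rw [hempty] at hI
  exact (Ultrafilter.neBot U).ne (Filter.empty_mem_iff_bot.mp hI)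

omit [CountableInterFilter (U : Filter A)] in
/-- At most one fibre of a function lies in an ultrafilter. [folklore] -/
private theorem fibre_unique {g : A → Multiplicative ℚ≥0} {q q' : Multiplicative ℚ≥0}
    (hq : g ⁻¹' {q} ∈ (U : Filter A)) (hq' : g ⁻¹' {q'} ∈ (U : Filter A)) : q = q' := by
  obtain ⟨a, ha, ha'⟩ := Filter.nonempty_of_mem (Filter.inter_mem hq hq')
  rw [Set.mem_preimage, Set.mem_singleton_iff] at ha ha'
  rw [← ha, ← ha']

/-- **The `U`-limit homomorphism.** For a countably complete ultrafilter `U` on `A` there is a homomorphism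
`L : (A → ℚ_{≥0}) → ℚ_{≥0}` (multiplicative notation) sending every function to the value of its unique fibre in
`U` — the "ghost" functional: additive, and trivial on functions that are trivial on a member of `U` (e.g. on
finitely supported functions when `U` is free). [folklore] -/
private theorem exists_limHom : ∃ L : (A → Multiplicative ℚ≥0) →* Multiplicative ℚ≥0,
    ∀ (g : A → Multiplicative ℚ≥0) (q : Multiplicative ℚ≥0), g ⁻¹' {q} ∈ (U : Filter A) → L g = q := by
  choose lim hlim using exists_fibre_mem U
  refine ⟨{ toFun := lim, map_one' := ?_, map_mul' := fun g g' => ?_ }, fun g q hq => fibre_unique U (hlim g) hq⟩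
  · apply fibre_unique U (hlim 1)
    have : (1 : A → Multiplicative ℚ≥0) ⁻¹' {1} = Set.univ := by
      ext a; simp
    rw [this]
    exact Filter.univ_mem
  · apply fibre_unique U (hlim (g * g'))
    apply Filter.mem_of_superset (Filter.inter_mem (hlim g) (hlim g'))
    intro a ha
    simp only [Set.mem_inter_iff, Set.mem_preimage, Set.mem_singleton_iff] at ha ⊢
    rw [Pi.mul_apply, ha.1, ha.2]

end Ultrafilter

/-! ### Arithmetic of the exponents: an irrational coefficient separates rational coordinates -/

/-- `p + c·q = p' + c·q'` with `p, q, p', q' ∈ ℚ` and `c` irrational forces `p = p'` and `q = q'`. [folklore] -/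
private theorem eq_of_add_irrational_mul_eq {c : ℝ} (hc : Irrational c) {p q p' q' : ℚ}
    (h : (p : ℝ) + c * q = p' + c * q') : p = p' ∧ q = q' := by
  by_cases hqq : q = q'
  · subst hqq
    refine ⟨?_, rfl⟩
    exact_mod_cast add_right_cancel h
  · exfalso
    have hne : (q : ℝ) - (q' : ℝ) ≠ 0 := by
      rw [sub_ne_zero]
      exact_mod_cast hqq
    apply hc
    refine ⟨(p' - p) / (q - q'), ?_⟩
    push_cast
    rw [div_eq_iff hne]
    linarith

/-! ### `ℚ_{≥0}`; homomorphisms out of `ℚ_{≥0}` into a realification are real powers -/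

/-- `ℚ_{≥0}` is (trivially) `ℚ`-monoprime, hence monoprime. [cite: MochizukiFrdI2008, §0 p.10] -/
theorem isMonoprime_nnrat : IsMonoprime (Multiplicative ℚ≥0) := IsMonoprime.ofQ ⟨⟨MulEquiv.refl _⟩⟩

/-- A homomorphism `φ : ℚ_{≥0} → K^rlf` is `q ↦ φ(1)^q` (real powers `rpow`: both sides have the same `den(q)`-th
power `φ(num(q))`, and roots are unique in `K^rlf`). [cite: MochizukiFrdI2008, Def. 2.4(i) p.48] -/
theorem hom_nnrat_eq_rpow {K : Type w} [CommMonoid K] (hK : IsPerfFactorial K)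
    (φ : Multiplicative ℚ≥0 →* hK.Rlf) (q : ℚ≥0) :
    φ (Multiplicative.ofAdd q) = IsPerfFactorial.Rlf.rpow hK (q : NNReal) (φ (Multiplicative.ofAdd 1)) := by
  have e1 : (Multiplicative.ofAdd q) ^ q.den = Multiplicative.ofAdd ((q.num : ℚ≥0)) := by
    rw [← ofAdd_nsmul, nsmul_eq_mul, NNRat.den_mul_eq_num]
  have e2 : (Multiplicative.ofAdd (1 : ℚ≥0)) ^ q.num = Multiplicative.ofAdd ((q.num : ℚ≥0)) := by
    rw [← ofAdd_nsmul, nsmul_eq_mul, mul_one]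
  have hpow : (φ (Multiplicative.ofAdd q)) ^ q.den = (φ (Multiplicative.ofAdd (1 : ℚ≥0))) ^ q.num := by
    rw [← map_pow φ, ← map_pow φ, e1, e2]
  rw [IsPerfFactorial.Rlf.eq_rpow_div_of_pow_eq hK q.num q.den_pos hpow]
  congr 1
  rw [← NNRat.cast_natCast q.num, ← NNRat.cast_natCast q.den, ← NNRat.cast_div, NNRat.num_div_den]

/-! ### The witness monoid `M = ∏_{A ⊕ A} ℚ_{≥0}` and its indicator vectors -/

/-- The witness divisor monoid: the FULL product `∏_{A ⊔ A} ℚ_{≥0}` (two copies of the index type).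
[cite: MochizukiFrdI2008, Def. 2.4(i) p.47] -/
abbrev WM (A : Type w) : Type w := A ⊕ A → Multiplicative ℚ≥0

variable (A : Type w)

/-- `∏_{A ⊔ A} ℚ_{≥0}` is perfect. [cite: MochizukiFrdI2008, §0 p.11] -/
theorem WM.isPerfect : IsPerfect (WM A) := PiMonoprime.isPerfect fun _ => isPerfect_multiplicative_nnrat

/-- `∏_{A ⊔ A} ℚ_{≥0}` is perf-factorial (`PiMonoprimePerfFactorial.lean`). [cite: MochizukiFrdI2008, Def. 2.4(i) p.47] -/
theorem WM.isPerfFactorial : IsPerfFactorial (WM A) := by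
  classical
  exact PiMonoprime.isPerfFactorial (fun _ => isMonoprime_nnrat) fun _ => isPerfect_multiplicative_nnrat

/-- The indicator `𝟙₁` of the first copy of `A` (value `1 ∈ ℚ_{≥0}` there, `0` on the second copy).
[cite: MochizukiFrdI2008, Def. 2.4(i) p.47] -/
def indicator₁ : WM A := Sum.elim (fun _ => Multiplicative.ofAdd 1) fun _ => 1

/-- The indicator `𝟙₂` of the second copy of `A`. [cite: MochizukiFrdI2008, Def. 2.4(i) p.47] -/
def indicator₂ : WM A := Sum.elim (fun _ => 1) fun _ => Multiplicative.ofAdd 1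

/-- `𝟙₁ = 1` on the first copy. [cite: MochizukiFrdI2008, Def. 2.4(i) p.47] -/
@[simp] theorem indicator₁_inl (k : A) : indicator₁ A (Sum.inl k) = Multiplicative.ofAdd 1 := rfl
/-- `𝟙₁ = 0` on the second copy. [cite: MochizukiFrdI2008, Def. 2.4(i) p.47] -/
@[simp] theorem indicator₁_inr (k : A) : indicator₁ A (Sum.inr k) = 1 := rfl
/-- `𝟙₂ = 0` on the first copy. [cite: MochizukiFrdI2008, Def. 2.4(i) p.47] -/
@[simp] theorem indicator₂_inl (k : A) : indicator₂ A (Sum.inl k) = 1 := rfl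
/-- `𝟙₂ = 1` on the second copy. [cite: MochizukiFrdI2008, Def. 2.4(i) p.47] -/
@[simp] theorem indicator₂_inr (k : A) : indicator₂ A (Sum.inr k) = Multiplicative.ofAdd 1 := rfl

/-- Restriction to the first copy: `a ↦ a|₁`. [cite: MochizukiFrdI2008, Def. 2.4(i) p.47] -/
def restrict₁ : WM A →* (A → Multiplicative ℚ≥0) :=
  MonoidHom.pi fun k => Pi.evalMonoidHom (fun _ : A ⊕ A => Multiplicative ℚ≥0) (Sum.inl k)

/-- Restriction to the second copy: `a ↦ a|₂`. [cite: MochizukiFrdI2008, Def. 2.4(i) p.47] -/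
def restrict₂ : WM A →* (A → Multiplicative ℚ≥0) :=
  MonoidHom.pi fun k => Pi.evalMonoidHom (fun _ : A ⊕ A => Multiplicative ℚ≥0) (Sum.inr k)

/-- `a|₁` evaluated. [cite: MochizukiFrdI2008, Def. 2.4(i) p.47] -/
@[simp] theorem restrict₁_apply (a : WM A) (k : A) : restrict₁ A a k = a (Sum.inl k) := rfl
/-- `a|₂` evaluated. [cite: MochizukiFrdI2008, Def. 2.4(i) p.47] -/
@[simp] theorem restrict₂_apply (a : WM A) (k : A) : restrict₂ A a k = a (Sum.inr k) := rfl

/-- The projection ENDOMORPHISM onto the coordinate `i`: `a ↦ (a_i at i, 0 elsewhere)`.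
[cite: MochizukiFrdI2008, Def. 2.4(i) p.47] -/
def proj [DecidableEq A] (i : A ⊕ A) : WM A →* WM A :=
  (MonoidHom.mulSingle (fun _ : A ⊕ A => Multiplicative ℚ≥0) i).comp
    (Pi.evalMonoidHom (fun _ : A ⊕ A => Multiplicative ℚ≥0) i)

/-- The projection endomorphism evaluated. [cite: MochizukiFrdI2008, Def. 2.4(i) p.47] -/
@[simp] theorem proj_apply [DecidableEq A] (i : A ⊕ A) (a : WM A) : proj A i a = Pi.mulSingle i (a i) := rfl

/-- The coordinate embedding `ℚ_{≥0} → M → M^rlf` at `i`. [cite: MochizukiFrdI2008, Def. 2.4(i) p.48] -/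
def coordHom [DecidableEq A] (i : A ⊕ A) : Multiplicative ℚ≥0 →* (WM.isPerfFactorial A).Rlf :=
  ((WM.isPerfFactorial A).toRealification.comp (Perfection.of _)).comp
    (MonoidHom.mulSingle (fun _ : A ⊕ A => Multiplicative ℚ≥0) i)

/-- The coordinate embedding evaluated. [cite: MochizukiFrdI2008, Def. 2.4(i) p.48] -/
theorem coordHom_apply [DecidableEq A] (i : A ⊕ A) (q : Multiplicative ℚ≥0) :
    coordHom A i q = (WM.isPerfFactorial A).toRealification (Perfection.of _ (Pi.mulSingle i q)) := rfl

/-- `coordHom i 1_{ℚ≥0} ≠ 0` (`ι : M → M^rlf` is injective). [cite: MochizukiFrdI2008, Def. 2.4(i) p.48] -/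
theorem coordHom_one_ne_one [DecidableEq A] (i : A ⊕ A) : coordHom A i (Multiplicative.ofAdd 1) ≠ 1 := by
  intro h1
  have h2 : (Pi.mulSingle i (Multiplicative.ofAdd (1 : ℚ≥0)) : WM A) = 1 :=
    IsPerfFactorial.Rlf.toRealification_of_injective (WM.isPerfFactorial A)
      (by rw [((WM.isPerfFactorial A).toRealification.comp (Perfection.of _)).map_one]; exact h1)
  have h3 := congr_fun h2 i
  rw [Pi.mulSingle_eq_same, Pi.one_apply] at h3
  exact one_ne_zero (Multiplicative.ofAdd.injective h3)

/-- The realified projection endomorphism on `ι a`: `(ι a)|_i = coordHom i (a i)`.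
[cite: MochizukiFrdI2008, Prop. 5.3 p.103] -/
theorem map_proj_toRealification [DecidableEq A] (i : A ⊕ A) (a : WM A) :
    IsPerfFactorial.Rlf.map (WM.isPerfFactorial A) (WM.isPerfFactorial A) (proj A i)
        ((WM.isPerfFactorial A).toRealification (Perfection.of _ a)) = coordHom A i (a i) := by
  rw [IsPerfFactorial.Rlf.map_toRealification_of]
  rfl

variable {A}

/-- The ghost exponent `a ↦ L(a|ⱼ) ∈ ℚ_{≥0} ⊆ ℝ_{≥0}` attached to a functional `L` and a restriction `r`.
[cite: MochizukiFrdI2008, Def. 2.4(i) p.47] -/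
def ghostExp (L : (A → Multiplicative ℚ≥0) →* Multiplicative ℚ≥0) (r : WM A →* (A → Multiplicative ℚ≥0))
    (a : WM A) : NNReal :=
  ((Multiplicative.toAdd (L (r a)) : ℚ≥0) : NNReal)

/-- The ghost exponent is additive. [cite: MochizukiFrdI2008, Def. 2.4(i) p.47] -/
theorem ghostExp_mul (L : (A → Multiplicative ℚ≥0) →* Multiplicative ℚ≥0) (r : WM A →* (A → Multiplicative ℚ≥0))
    (a b : WM A) : ghostExp L r (a * b) = ghostExp L r a + ghostExp L r b := by
  simp only [ghostExp, map_mul, toAdd_mul, NNRat.cast_add]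

/-- `ghostExp L r 1 = 0`. [cite: MochizukiFrdI2008, Def. 2.4(i) p.47] -/
theorem ghostExp_one (L : (A → Multiplicative ℚ≥0) →* Multiplicative ℚ≥0) (r : WM A →* (A → Multiplicative ℚ≥0)) :
    ghostExp L r 1 = 0 := by
  simp only [ghostExp, map_one, toAdd_one, NNRat.cast_zero]

/-- The ghost exponent of `a` vanishes as soon as `a|ⱼ` is trivial on a member of `U` (for the `U`-limit `L`).
[cite: MochizukiFrdI2008, Def. 2.4(i) p.47] -/
theorem ghostExp_eq_zero (U : Ultrafilter A) {L : (A → Multiplicative ℚ≥0) →* Multiplicative ℚ≥0}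
    (hL : ∀ (g : A → Multiplicative ℚ≥0) (q : Multiplicative ℚ≥0), g ⁻¹' {q} ∈ (U : Filter A) → L g = q)
    (r : WM A →* (A → Multiplicative ℚ≥0)) {a : WM A} (ha : {k | r a k = 1} ∈ (U : Filter A)) :
    ghostExp L r a = 0 := by
  rw [ghostExp, hL (r a) 1 ha, toAdd_one, NNRat.cast_zero]

/-- The ghost exponent of `a` is `1` when `a|ⱼ ≡ 1`. [cite: MochizukiFrdI2008, Def. 2.4(i) p.47] -/
theorem ghostExp_eq_one (U : Ultrafilter A) {L : (A → Multiplicative ℚ≥0) →* Multiplicative ℚ≥0}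
    (hL : ∀ (g : A → Multiplicative ℚ≥0) (q : Multiplicative ℚ≥0), g ⁻¹' {q} ∈ (U : Filter A) → L g = q)
    (r : WM A →* (A → Multiplicative ℚ≥0)) {a : WM A} (ha : ∀ k, r a k = Multiplicative.ofAdd 1) :
    ghostExp L r a = 1 := by
  have : L (r a) = Multiplicative.ofAdd 1 := by
    apply hL
    apply Filter.mem_of_superset Filter.univ_mem
    intro k _
    exact ha k
  rw [ghostExp, this, toAdd_ofAdd, NNRat.cast_one]

/-- For a FREE ultrafilter, the ghost exponents of an element supported at a single index vanish.
[cite: MochizukiFrdI2008, Def. 2.4(i) p.47] -/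
theorem ghostExp_eq_zero_of_dsupp_subset (U : Ultrafilter A) (hUfree : ∀ k : A, ({k}ᶜ : Set A) ∈ (U : Filter A))
    {L : (A → Multiplicative ℚ≥0) →* Multiplicative ℚ≥0}
    (hL : ∀ (g : A → Multiplicative ℚ≥0) (q : Multiplicative ℚ≥0), g ⁻¹' {q} ∈ (U : Filter A) → L g = q)
    {a : WM A} {i : A ⊕ A} (ha : dsupp a ⊆ {i}) :
    ghostExp L (restrict₁ A) a = 0 ∧ ghostExp L (restrict₂ A) a = 0 := by
  have key : ∀ (emb : A → A ⊕ A), Injective emb → {k | a (emb k) = 1} ∈ (U : Filter A) := by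
    intro emb hemb
    by_cases hi : ∃ k₀, emb k₀ = i
    · obtain ⟨k₀, hk₀⟩ := hi
      apply Filter.mem_of_superset (hUfree k₀)
      intro k hk
      by_contra hne
      have : emb k = i := ha hne
      exact hk (hemb (this.trans hk₀.symm))
    · refine Filter.mem_of_superset Filter.univ_mem fun k _ => ?_
      by_contra hne
      exact hi ⟨k, ha hne⟩
  exact ⟨ghostExp_eq_zero U hL _ (key Sum.inl Sum.inl_injective),
    ghostExp_eq_zero U hL _ (key Sum.inr Sum.inr_injective)⟩

/-! ### The witness homomorphism `f a = ι a · ι(𝟙₁)^{√2·L(a|₂)} · ι(𝟙₂)^{L(a|₁)/√2}` -/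

/-- **The witness homomorphism** `f : ∏_{A ⊔ A} ℚ_{≥0} → (∏_{A ⊔ A} ℚ_{≥0})^rlf`,
`f a = ι a · ι(𝟙₁)^{√2 · L(a|₂)} · ι(𝟙₂)^{(1/√2) · L(a|₁)}` for a functional `L` on `A → ℚ_{≥0}`.
[cite: MochizukiFrdI2008, Prop. 5.3 p.103] -/
def witnessHom (L : (A → Multiplicative ℚ≥0) →* Multiplicative ℚ≥0) : WM A →* (WM.isPerfFactorial A).Rlf where
  toFun a := (WM.isPerfFactorial A).toRealification (Perfection.of _ a) *
    IsPerfFactorial.Rlf.rpow (WM.isPerfFactorial A) (NNReal.sqrt 2 * ghostExp L (restrict₂ A) a)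
      ((WM.isPerfFactorial A).toRealification (Perfection.of _ (indicator₁ A))) *
    IsPerfFactorial.Rlf.rpow (WM.isPerfFactorial A) ((NNReal.sqrt 2)⁻¹ * ghostExp L (restrict₁ A) a)
      ((WM.isPerfFactorial A).toRealification (Perfection.of _ (indicator₂ A)))
  map_one' := by
    rw [ghostExp_one, ghostExp_one, mul_zero, mul_zero, ← Nat.cast_zero, IsPerfFactorial.Rlf.rpow_natCast,
      IsPerfFactorial.Rlf.rpow_natCast, pow_zero, pow_zero, map_one, map_one, one_mul, one_mul]
  map_mul' a b := by
    rw [map_mul, map_mul, ghostExp_mul, ghostExp_mul, mul_add, mul_add, IsPerfFactorial.Rlf.rpow_add,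
      IsPerfFactorial.Rlf.rpow_add]
    ac_rfl

/-- `witnessHom` unfolded. [cite: MochizukiFrdI2008, Prop. 5.3 p.103] -/
theorem witnessHom_apply (L : (A → Multiplicative ℚ≥0) →* Multiplicative ℚ≥0) (a : WM A) :
    witnessHom L a = (WM.isPerfFactorial A).toRealification (Perfection.of _ a) *
      IsPerfFactorial.Rlf.rpow (WM.isPerfFactorial A) (NNReal.sqrt 2 * ghostExp L (restrict₂ A) a)
        ((WM.isPerfFactorial A).toRealification (Perfection.of _ (indicator₁ A))) *
      IsPerfFactorial.Rlf.rpow (WM.isPerfFactorial A) ((NNReal.sqrt 2)⁻¹ * ghostExp L (restrict₁ A) a)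
        ((WM.isPerfFactorial A).toRealification (Perfection.of _ (indicator₂ A))) := rfl

/-- The realified projection to a coordinate `k` of the FIRST copy: `(f a)|_k = x_k^{a_k + √2 · L(a|₂)}`,
`x_k = coordHom k (1)`. [cite: MochizukiFrdI2008, Prop. 5.3 p.103] -/
theorem map_proj_inl_witnessHom [DecidableEq A] (L : (A → Multiplicative ℚ≥0) →* Multiplicative ℚ≥0)
    (k : A) (a : WM A) :
    IsPerfFactorial.Rlf.map (WM.isPerfFactorial A) (WM.isPerfFactorial A) (proj A (Sum.inl k)) (witnessHom L a) =
      IsPerfFactorial.Rlf.rpow (WM.isPerfFactorial A)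
        (((Multiplicative.toAdd (a (Sum.inl k)) : ℚ≥0) : NNReal) + NNReal.sqrt 2 * ghostExp L (restrict₂ A) a)
        (coordHom A (Sum.inl k) (Multiplicative.ofAdd 1)) := by
  rw [witnessHom_apply, map_mul, map_mul, IsPerfFactorial.Rlf.map_rpow', IsPerfFactorial.Rlf.map_rpow',
    map_proj_toRealification, map_proj_toRealification, map_proj_toRealification, indicator₁_inl, indicator₂_inl,
    (coordHom A (Sum.inl k)).map_one,
    (IsPerfFactorial.Rlf.rpow (WM.isPerfFactorial A) ((NNReal.sqrt 2)⁻¹ * ghostExp L (restrict₁ A) a)).map_one,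
    mul_one, IsPerfFactorial.Rlf.rpow_add]
  congr 1
  rw [← hom_nnrat_eq_rpow, ofAdd_toAdd]

/-- The realified projection to a coordinate `k` of the SECOND copy: `(f a)|_k = x_k^{a_k + (1/√2) · L(a|₁)}`.
[cite: MochizukiFrdI2008, Prop. 5.3 p.103] -/
theorem map_proj_inr_witnessHom [DecidableEq A] (L : (A → Multiplicative ℚ≥0) →* Multiplicative ℚ≥0)
    (k : A) (a : WM A) :
    IsPerfFactorial.Rlf.map (WM.isPerfFactorial A) (WM.isPerfFactorial A) (proj A (Sum.inr k)) (witnessHom L a) =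
      IsPerfFactorial.Rlf.rpow (WM.isPerfFactorial A)
        (((Multiplicative.toAdd (a (Sum.inr k)) : ℚ≥0) : NNReal) + (NNReal.sqrt 2)⁻¹ * ghostExp L (restrict₁ A) a)
        (coordHom A (Sum.inr k) (Multiplicative.ofAdd 1)) := by
  rw [witnessHom_apply, map_mul, map_mul, IsPerfFactorial.Rlf.map_rpow', IsPerfFactorial.Rlf.map_rpow',
    map_proj_toRealification, map_proj_toRealification, map_proj_toRealification, indicator₁_inr, indicator₂_inr,
    (coordHom A (Sum.inr k)).map_one,
    (IsPerfFactorial.Rlf.rpow (WM.isPerfFactorial A) (NNReal.sqrt 2 * ghostExp L (restrict₂ A) a)).map_one,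
    mul_one, IsPerfFactorial.Rlf.rpow_add]
  congr 1
  rw [← hom_nnrat_eq_rpow, ofAdd_toAdd]

/-- `√2` is irrational, read on `NNReal.sqrt 2`. [folklore] -/
private theorem irrational_coe_sqrt_two : Irrational ((NNReal.sqrt 2 : NNReal) : ℝ) := by
  rw [Real.coe_sqrt, NNReal.coe_ofNat]
  exact irrational_sqrt_two

/-- `1/√2` is irrational. [folklore] -/
private theorem irrational_coe_sqrt_two_inv : Irrational (((NNReal.sqrt 2)⁻¹ : NNReal) : ℝ) := by
  rw [NNReal.coe_inv, irrational_inv_iff]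
  exact irrational_coe_sqrt_two

/-- From an equality of real exponents `a + C·x = b + C·y` (`a, b, x, y ∈ ℚ_{≥0}`, `C` irrational) to `a = b`.
[folklore] -/
private theorem nnrat_eq_of_exponent_eq {C : NNReal} (hC : Irrational (C : ℝ)) {a x b y : ℚ≥0}
    (h : (a : NNReal) + C * (x : NNReal) = (b : NNReal) + C * (y : NNReal)) : a = b := by
  have h' : ((a : ℚ) : ℝ) + (C : ℝ) * ((x : ℚ) : ℝ) = ((b : ℚ) : ℝ) + (C : ℝ) * ((y : ℚ) : ℝ) := by
    have e : ∀ q : ℚ≥0, ((q : NNReal) : ℝ) = ((q : ℚ) : ℝ) := fun q => by norm_cast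
    have := congrArg NNReal.toReal h
    rw [NNReal.coe_add, NNReal.coe_add, NNReal.coe_mul, NNReal.coe_mul, e, e, e, e] at this
    exact this
  have := (eq_of_add_irrational_mul_eq hC h').1
  exact_mod_cast this

/-- **The witness homomorphism is injective** (`√2 ∉ ℚ`, coordinate by coordinate).
[cite: MochizukiFrdI2008, Prop. 5.3 p.103] -/
theorem witnessHom_injective (L : (A → Multiplicative ℚ≥0) →* Multiplicative ℚ≥0) : Injective (witnessHom L) := by
  classical
  intro a b hab
  funext i
  rcases i with k | k
  · have h := congrArg (IsPerfFactorial.Rlf.map (WM.isPerfFactorial A) (WM.isPerfFactorial A)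
      (proj A (Sum.inl k))) hab
    rw [map_proj_inl_witnessHom, map_proj_inl_witnessHom] at h
    exact Multiplicative.toAdd.injective (nnrat_eq_of_exponent_eq irrational_coe_sqrt_two
      (IsPerfFactorial.Rlf.rpow_left_cancel (WM.isPerfFactorial A) (coordHom_one_ne_one A _) h))
  · have h := congrArg (IsPerfFactorial.Rlf.map (WM.isPerfFactorial A) (WM.isPerfFactorial A)
      (proj A (Sum.inr k))) hab
    rw [map_proj_inr_witnessHom, map_proj_inr_witnessHom] at h
    exact Multiplicative.toAdd.injective (nnrat_eq_of_exponent_eq irrational_coe_sqrt_two_inv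
      (IsPerfFactorial.Rlf.rpow_left_cancel (WM.isPerfFactorial A) (coordHom_one_ne_one A _) h))

/-- The witness homomorphism is characteristically injective (its target is sharp).
[cite: MochizukiFrdI2008, §0 p.11] -/
theorem isCharInjective_witnessHom (L : (A → Multiplicative ℚ≥0) →* Multiplicative ℚ≥0) :
    IsCharInjective (witnessHom L) := by
  refine ⟨witnessHom_injective L, fun p p' hpp' => ?_⟩
  obtain ⟨a, rfl⟩ := Associates.mk_surjective p
  obtain ⟨a', rfl⟩ := Associates.mk_surjective p'
  rw [associatesMap_mk, associatesMap_mk, Associates.mk_eq_mk_iff_associated] at hpp'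
  obtain ⟨v, hv⟩ := hpp'
  have hv1 : (v : (WM.isPerfFactorial A).Rlf) = 1 := (IsPerfFactorial.Rlf.isSharp (WM.isPerfFactorial A)).1 _ v.isUnit
  rw [hv1, mul_one] at hv
  rw [witnessHom_injective L hv]

/-! ### The witness satisfies the disjointness hypothesis of the slot -/

/-- A primary element of `M^pf` (`M = ∏_{A ⊔ A} ℚ_{≥0}`, perfect) is `ι a` for an `a` supported at one index, and
(for a free ultrafilter) `f^pf` maps it to `ι(ι a)`. [cite: MochizukiFrdI2008, §0 p.12] -/
theorem exists_of_mem_carrier (U : Ultrafilter A) (hUfree : ∀ k : A, ({k}ᶜ : Set A) ∈ (U : Filter A))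
    {L : (A → Multiplicative ℚ≥0) →* Multiplicative ℚ≥0}
    (hL : ∀ (g : A → Multiplicative ℚ≥0) (q : Multiplicative ℚ≥0), g ⁻¹' {q} ∈ (U : Filter A) → L g = q)
    {𝔭 : Primes (Perfection (WM A))} {x : Perfection (WM A)} (hx : x ∈ 𝔭.carrier) :
    ∃ a : WM A, ∃ i : A ⊕ A, dsupp a = {i} ∧ x = Perfection.of _ a ∧
      Perfection.map (witnessHom L) x = Perfection.of _ ((WM.isPerfFactorial A).toRealification (Perfection.of _ a)) := by
  classical
  obtain ⟨a, rfl⟩ := (isPerfect_iff_bijective_of.mp (WM.isPerfect A)).2 x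
  have ha : IsPrimary a := (Perfection.isPrimary_of_iff (WM.isPerfFactorial A).isDivisorial.isSharp).mp hx.1
  obtain ⟨i, hi⟩ := (PiMonoprime.isPrimary_iff (fun _ => isMonoprime_nnrat) a).mp ha
  refine ⟨a, i, hi, rfl, ?_⟩
  obtain ⟨h1, h2⟩ := ghostExp_eq_zero_of_dsupp_subset U hUfree hL hi.le
  show Perfection.of _ (witnessHom L a) = _
  rw [witnessHom_apply, h1, h2, mul_zero, mul_zero, ← Nat.cast_zero, IsPerfFactorial.Rlf.rpow_natCast,
    IsPerfFactorial.Rlf.rpow_natCast, pow_zero, pow_zero, mul_one, mul_one]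

/-- **The disjointness hypothesis of `RlfMapInjective'` holds for the witness**: primaries of distinct primes of
`M^pf` go (under `f^pf`, then `ι_N`) to elements of `N^rlf` with disjoint — indeed distinct singleton — supports.
[cite: MochizukiFrdI2008, Prop. 5.3 p.103] -/
theorem disjoint_supp_witnessHom (U : Ultrafilter A) (hUfree : ∀ k : A, ({k}ᶜ : Set A) ∈ (U : Filter A))
    {L : (A → Multiplicative ℚ≥0) →* Multiplicative ℚ≥0}
    (hL : ∀ (g : A → Multiplicative ℚ≥0) (q : Multiplicative ℚ≥0), g ⁻¹' {q} ∈ (U : Filter A) → L g = q)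
    (𝔭 𝔮 : Primes (Perfection (WM A))) (hne : 𝔭 ≠ 𝔮) (x : Perfection (WM A)) (hx : x ∈ 𝔭.carrier)
    (y : Perfection (WM A)) (hy : y ∈ 𝔮.carrier) :
    Disjoint
      (supp ((WM.isPerfFactorial A).RealificationIsPerfFactorial_holds.toRealification
        (Perfection.map (witnessHom L) x) : RlfFactor (WM.isPerfFactorial A).Rlf))
      (supp ((WM.isPerfFactorial A).RealificationIsPerfFactorial_holds.toRealification
        (Perfection.map (witnessHom L) y) : RlfFactor (WM.isPerfFactorial A).Rlf)) := by
  have hM := WM.isPerfFactorial A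
  have hN : IsPerfFactorial (WM.isPerfFactorial A).Rlf := (WM.isPerfFactorial A).RealificationIsPerfFactorial_holds
  obtain ⟨a, i, hi, rfl, hfx⟩ := exists_of_mem_carrier U hUfree hL hx
  obtain ⟨b, j, hj, rfl, hfy⟩ := exists_of_mem_carrier U hUfree hL hy
  rw [hfx, hfy]
  have hsa := IsPerfFactorial.Rlf.supp_toRealification_of_mem_carrier (WM.isPerfFactorial A) hx
  have hsb := IsPerfFactorial.Rlf.supp_toRealification_of_mem_carrier (WM.isPerfFactorial A) hy
  have hza : IsPrimary ((WM.isPerfFactorial A).toRealification (Perfection.of _ a)) :=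
    (IsPerfFactorial.Rlf.isPrimary_iff (WM.isPerfFactorial A) _).mpr ⟨𝔭, hsa⟩
  have hzb : IsPrimary ((WM.isPerfFactorial A).toRealification (Perfection.of _ b)) :=
    (IsPerfFactorial.Rlf.isPrimary_iff (WM.isPerfFactorial A) _).mpr ⟨𝔮, hsb⟩
  have hza' := (Perfection.isPrimary_of_iff (IsPerfFactorial.Rlf.isSharp (WM.isPerfFactorial A))).mpr hza
  have hzb' := (Perfection.isPrimary_of_iff (IsPerfFactorial.Rlf.isSharp (WM.isPerfFactorial A))).mpr hzb
  rw [IsPerfFactorial.Rlf.supp_toRealification_of_mem_carrier hN (mem_carrier_mk_of_isPrimary hza'),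
    IsPerfFactorial.Rlf.supp_toRealification_of_mem_carrier hN (mem_carrier_mk_of_isPrimary hzb'),
    Set.disjoint_singleton]
  intro heq
  apply hne
  have h1 := Quotient.exact (s := primarySetoid (Perfection (WM.isPerfFactorial A).Rlf)) heq
  have h2 : (WM.isPerfFactorial A).toRealification (Perfection.of _ a) ≼
      (WM.isPerfFactorial A).toRealification (Perfection.of _ b) := Perfection.of_precsim_of_iff.mp h1
  have h3 := IsPerfFactorial.Rlf.supp_subset_of_precsim (WM.isPerfFactorial A) h2
  rw [hsa, hsb, Set.singleton_subset_singleton] at h3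
  exact h3

/-! ### The collision `f^rlf(ι 𝟙₂) = f^rlf(ι(𝟙₁)^{√2})` -/

/-- `√2 · (1/√2) = 1` in `ℝ_{≥0}`. [folklore] -/
private theorem sqrt_two_mul_inv : NNReal.sqrt 2 * (NNReal.sqrt 2)⁻¹ = 1 :=
  mul_inv_cancel₀ (by rw [ne_eq, NNReal.sqrt_eq_zero]; norm_num)

/-- **`f^rlf` identifies `ι 𝟙₂` and `ι(𝟙₁)^{√2}`** (for the `U`-limit `L`): both go to `ι_N(ι 𝟙₂ · ι(𝟙₁)^{√2})`.
[cite: MochizukiFrdI2008, Prop. 5.3 p.103] -/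
theorem map_witnessHom_collision (U : Ultrafilter A) {L : (A → Multiplicative ℚ≥0) →* Multiplicative ℚ≥0}
    (hL : ∀ (g : A → Multiplicative ℚ≥0) (q : Multiplicative ℚ≥0), g ⁻¹' {q} ∈ (U : Filter A) → L g = q) :
    IsPerfFactorial.Rlf.map (WM.isPerfFactorial A) (WM.isPerfFactorial A).RealificationIsPerfFactorial_holds
        (witnessHom L) ((WM.isPerfFactorial A).toRealification (Perfection.of _ (indicator₂ A))) =
      IsPerfFactorial.Rlf.map (WM.isPerfFactorial A) (WM.isPerfFactorial A).RealificationIsPerfFactorial_holds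
        (witnessHom L) (IsPerfFactorial.Rlf.rpow (WM.isPerfFactorial A) (NNReal.sqrt 2)
          ((WM.isPerfFactorial A).toRealification (Perfection.of _ (indicator₁ A)))) := by
  have hN : IsPerfFactorial (WM.isPerfFactorial A).Rlf := (WM.isPerfFactorial A).RealificationIsPerfFactorial_holds
  have h11 : ghostExp L (restrict₁ A) (indicator₁ A) = 1 := ghostExp_eq_one U hL _ fun k => rfl
  have h21 : ghostExp L (restrict₂ A) (indicator₁ A) = 0 :=
    ghostExp_eq_zero U hL _ (Filter.mem_of_superset Filter.univ_mem fun k _ => rfl)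
  have h12 : ghostExp L (restrict₁ A) (indicator₂ A) = 0 :=
    ghostExp_eq_zero U hL _ (Filter.mem_of_superset Filter.univ_mem fun k _ => rfl)
  have h22 : ghostExp L (restrict₂ A) (indicator₂ A) = 1 := ghostExp_eq_one U hL _ fun k => rfl
  have rpow0 : ∀ z : (WM.isPerfFactorial A).Rlf, IsPerfFactorial.Rlf.rpow (WM.isPerfFactorial A) 0 z = 1 := by
    intro z
    have := IsPerfFactorial.Rlf.rpow_natCast (WM.isPerfFactorial A) 0 z
    rwa [Nat.cast_zero, pow_zero] at this
  have rpow1 : ∀ z : (WM.isPerfFactorial A).Rlf, IsPerfFactorial.Rlf.rpow (WM.isPerfFactorial A) 1 z = z := by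
    intro z
    have := IsPerfFactorial.Rlf.rpow_natCast (WM.isPerfFactorial A) 1 z
    rwa [Nat.cast_one, pow_one] at this
  rw [IsPerfFactorial.Rlf.map_rpow', IsPerfFactorial.Rlf.map_toRealification_of,
    IsPerfFactorial.Rlf.map_toRealification_of, witnessHom_apply, witnessHom_apply, h11, h21, h12, h22,
    mul_zero, mul_zero, mul_one, mul_one, rpow0, rpow0, mul_one, mul_one]
  -- `ι_N (ι𝟙₂ · ι(𝟙₁)^{√2}) = (ι_N (ι𝟙₁ · ι(𝟙₂)^{1/√2}))^{√2}`: every hom of realifications commutes with `rpow`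
  have key := IsPerfFactorial.Rlf.map_rpow (WM.isPerfFactorial A) hN (hN.toRealification.comp (Perfection.of _))
    (NNReal.sqrt 2)
    ((WM.isPerfFactorial A).toRealification (Perfection.of _ (indicator₁ A)) *
      IsPerfFactorial.Rlf.rpow (WM.isPerfFactorial A) (NNReal.sqrt 2)⁻¹
        ((WM.isPerfFactorial A).toRealification (Perfection.of _ (indicator₂ A))))
  rw [map_mul, ← IsPerfFactorial.Rlf.rpow_mul, sqrt_two_mul_inv, rpow1, mul_comm] at key
  exact key

/-- **…but `ι 𝟙₂ ≠ ι(𝟙₁)^{√2}`** (project to a coordinate of the second copy: `ι(1)` versus `0`).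
[cite: MochizukiFrdI2008, Prop. 5.3 p.103] -/
theorem indicator_ne [Nonempty A] :
    (WM.isPerfFactorial A).toRealification (Perfection.of _ (indicator₂ A)) ≠
      IsPerfFactorial.Rlf.rpow (WM.isPerfFactorial A) (NNReal.sqrt 2)
        ((WM.isPerfFactorial A).toRealification (Perfection.of _ (indicator₁ A))) := by
  classical
  intro h
  obtain ⟨k⟩ := ‹Nonempty A›
  have h' := congrArg (IsPerfFactorial.Rlf.map (WM.isPerfFactorial A) (WM.isPerfFactorial A)
    (proj A (Sum.inr k))) h
  rw [IsPerfFactorial.Rlf.map_rpow', map_proj_toRealification, map_proj_toRealification, indicator₂_inr,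
    indicator₁_inr, (coordHom A (Sum.inr k)).map_one,
    (IsPerfFactorial.Rlf.rpow (WM.isPerfFactorial A) (NNReal.sqrt 2)).map_one] at h'
  exact coordHom_one_ne_one A _ h'

/-! ### The theorem -/

/-- **Finding P53-F2 (negative half): the slot `RlfMapInjective'` is refutable from a countably complete free
ultrafilter.**  If some type `A` of the universe carries an ultrafilter closed under countable intersections and
containing all complements of points, then `M := ∏_{A ⊔ A} ℚ_{≥0}` (perf-factorial), `N := M^rlf` and the witness
homomorphism `f` built from the `U`-limit functional refute the slot: `f` is characteristically injective and
sends primaries of distinct primes to elements with disjoint supports, yet `f^rlf` is not injective.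
[cite: MochizukiFrdI2008, Prop. 5.3 p.103] -/
theorem not_rlfMapInjective'_of_countableInter_ultrafilter
    (H : ∃ (A : Type w) (U : Ultrafilter A), CountableInterFilter (U : Filter A) ∧
      ∀ a : A, ({a}ᶜ : Set A) ∈ (U : Filter A)) :
    ¬ FrdI.Prop53Sub.RlfMapInjective'.{w} := by
  obtain ⟨A, U, hUc, hUfree⟩ := H
  haveI := hUc
  haveI : Nonempty A := by
    obtain ⟨a, _⟩ := Filter.nonempty_of_mem (Filter.univ_mem (f := (U : Filter A)))
    exact ⟨a⟩
  intro HS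
  obtain ⟨L, hL⟩ := exists_limHom U
  exact indicator_ne (A := A)
    (HS (WM.isPerfFactorial A) (WM.isPerfFactorial A).RealificationIsPerfFactorial_holds (witnessHom L)
      (isCharInjective_witnessHom L) (disjoint_supp_witnessHom U hUfree hL) (map_witnessHom_collision U hL))

end P53F2

end Literature.AlgebraicGeometry.Frobenioids
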